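import Summits.ValiantsHypothesis.ValiantsHypothesis.Theorems.LacunarySymmetroidMatrixDescartesLocalMultiplicityDefs

/-!
# `MatrixDescartes` — local (multiplicity) census column: the located floor `μ(2,4) ≥ 8`

HONEST FRAMING.  Object-search cell `pub-symmetroid` (Valiant), local census column of the crux `MatrixDescartes`
(ledger item `stmt-ValiantsHypothesis-18050`; crux-idea «local-multiplicity-law», ideator seat val-idea-4).  One
census row, sorry-free, in the vocabulary of record (`LacunarySymmetroidMatrixDescartesLocalMultiplicityDefs`).
Nothing is asserted about `MatrixDescartes`, Conjecture B (`KPlusLogSqLaw`) or `VP ≠ VNP`.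

THE ROW.  `localFloor_2_4 : ¬ LocalRootLawAt 2 4 7`, i.e. `μ(2,4) ≥ 8`: the INTEGER four-letter symmetric `2 × 2`
pencil on exponents `(0,1,3,4)`
`S₀ = diag(1,−1)`, `S₁ = [[−6,4],[4,2]]`, `S₂ = [[−58,−12],[−12,−2]]`, `S₃ = [[63,8],[8,1]]`
has `det (S₀ + t S₁ + t³ S₂ + t⁴ S₃) = −(t − 1)⁸` (`pencilDet_S24w`), an `8`-fold root at `t = 1` with `det ≢ 0`.
Found by the seat's exact Gram-level search (`exp/levelscan.py`: on the one-collision support `(0,1,3,4)` the apex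
Gram pencil contains the integer rank-`3` Gram of inertia `(2,1)` at `λ = 4`), realised over `ℤ` by a small search.

CONTEXT (located, not claimed here): with the landed `stub_localDescartes 2 4 : LocalRootLawAt 2 4 9`, the record
row `stub_local_2_4_record` (`μ ≤ 8` on the census record support `(0,2,6,11)`), and the seat's exact scan
«apex Gram nonsingular on all 8406 Sidon supports `(0,d₁,d₂,d₃)`, `d₃ ≤ 40`» this locates `μ(2,4) = 8 < 9 = ζ(2,4)`
(coalescence capacity strictly below root capacity at `(2,4)`); the format-level statement `LocalRootLawAt 2 4 8`
remains a prediction (PRED-L3), not a theorem.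
-/

set_option autoImplicit false

namespace Summit.ValiantsHypothesis.ValiantsHypothesis.Theorems.LacunarySymmetroidMatrixDescartes

open Polynomial

namespace LocalMultiplicity

/-- exponents `(0,1,3,4)` of the `(2,4)` floor witness. -/
def d24w : Fin 4 → ℕ := ![0, 1, 3, 4]

/-- letters of the `(2,4)` floor witness: `diag(1,−1)`, `[[−6,4],[4,2]]`, `[[−58,−12],[−12,−2]]`, `[[63,8],[8,1]]`. -/
def S24w : Fin 4 → Matrix (Fin 2) (Fin 2) ℝ :=
  ![!![1, 0; 0, -1], !![-6, 4; 4, 2], !![-58, -12; -12, -2], !![63, 8; 8, 1]]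

/-- the witness letters are symmetric. [elementary] -/
theorem S24w_isSymm (l : Fin 4) : (S24w l).IsSymm := by
  fin_cases l <;> refine Matrix.IsSymm.ext (fun i j => ?_) <;> fin_cases i <;> fin_cases j <;> simp [S24w]

/-- `det (S₀ + t S₁ + t³ S₂ + t⁴ S₃) = −(t − 1)⁸`. [elementary] -/
theorem pencilDet_S24w : pencilDet d24w S24w = (X - C 1) ^ 8 * C (-1) := by
  unfold pencilDet
  rw [Fin.sum_univ_four, Matrix.det_fin_two]
  simp [d24w, S24w, Matrix.smul_apply, Matrix.map_apply, Matrix.add_apply, Polynomial.C_ofNat]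
  ring

/-- the witness determinant is not the zero polynomial. [elementary] -/
theorem pencilDet_S24w_ne_zero : pencilDet d24w S24w ≠ 0 := by
  rw [pencilDet_S24w]
  exact mul_ne_zero (pow_ne_zero _ (X_sub_C_ne_zero 1)) (by simp)

/-- the witness determinant vanishes at `t = 1` to order exactly `8`. [elementary] -/
theorem rootMultiplicity_S24w : (pencilDet d24w S24w).rootMultiplicity 1 = 8 := by
  have hne : (X - C (1:ℝ)) ^ 8 * C (-1) ≠ 0 := mul_ne_zero (pow_ne_zero _ (X_sub_C_ne_zero 1)) (by simp)
  rw [pencilDet_S24w, Polynomial.rootMultiplicity_mul hne, Polynomial.rootMultiplicity_X_sub_C_pow,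
    Polynomial.rootMultiplicity_C]

end LocalMultiplicity

open LocalMultiplicity in
/-- **Row `localFloor_2_4` — the located floor `(2,4)`: `¬ LocalRootLawAt 2 4 7`, i.e. `μ(2,4) ≥ 8`** (an `8`-fold
positive root of a non-degenerate symmetric four-letter `2 × 2` pencil; two more than the diagonal floor
`m(K−1) = 6` of `stub_localFloor`, one less than the Descartes ceiling `9` of `stub_localDescartes`). [elementary] -/
theorem localFloor_2_4 : ¬ LocalRootLawAt 2 4 7 := by
  intro h
  have h8 := h d24w S24w S24w_isSymm pencilDet_S24w_ne_zero
  rw [rootMultiplicity_S24w] at h8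
  omega

end Summit.ValiantsHypothesis.ValiantsHypothesis.Theorems.LacunarySymmetroidMatrixDescartes
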